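import Summits.HodgeConjecture.HodgeConjecture.Theorems.F0LD2LineComplementaryOfDisjoint
import Literature.NumberTheory.GelbartRogawski1991.LocalSplittingCMThetaCentreDoublingLines
import HarnessLib

-- SPLIT NOTE (A-p13 g40, LD2-plan (g3) DEALS #14 (1)): this module = §1 (the four brick `def`s, STATEMENT-ONLY) of LD2-plan (g3)'s soft-road junction
-- skeleton v2 `F0/P6/LD/LD2-plan/g3/LTC1.softroad.junction.skeleton.v2.LD2-plang3.lean` (sha16 3b896be9915347f3); the sorry-free glue + the two remaining
-- stubs live in the junction skeleton v3, which imports this file.  The namespace is `…Cruxes.HLiu418.F0LD2SoftRoadJunction` in BOTH modules so every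
-- announced constant keeps its fully-qualified name.  The four `def` BODIES are byte-identical to skeleton v2 :78–:166; only their docstrings lost the
-- `cite` TAGS (organ defs are route-posited bricks, not published facts — a tagged `def : Prop` under Summits is relocated to Literature by the gate;
-- ★ `F0LD1ThetaSliceBricks` ∕ ★ `F0LD1ThetaGermDefs` convention).  Pattern: ★ p850919 `Theorems/F0LD1ThetaSliceBricks.lean`.

/-!
# Crux `HLiu418`, line LD2 — the FOUR BRICKS of the soft-road junction for the organ `LineThetaTypesComplementary₁` (statement-only defs leaf)

Cell `hodgecm-mathlib` (D-0151), half A line LD2, seat A-p13 (g40) for LD2-plan (g3), 2026-09-02.  Crux hLiu418 = `stmt-HodgeConjecture-24832`; leaf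
`Cruxes/HLiu418/Lines/F0_P6LD_StubS1bFactsOrganRoad.lean` ED. 7, organ stub `stub_organ_lineTypes₁ : F0LD2LineThetaTypesComplementaryDefs.LineThetaTypesComplementary₁`
(books row #188).  THIS FILE: the four brick `Prop`s of the SOFT-ROAD JUNCTION (π3 ∘ E3 ∘ π2-J ∘ π1) over ONE binder discipline, and NOTHING ELSE (0 theorems,
0 `sorry`, no instance, no notation): the junction `lineThetaTypesComplementary₁_of_softRoad : CentreDetCharExists → AnisotropicPlaneCentreTypeVanishes →
(KudlaLinesDisjoint → CoinvDisjoint₁) → LineThetaTypesComplementary₁` and its payers type their heads against THESE constants, literally: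
★ `F0LD2CentreDetCharExists.centreDetCharExists` (E; docks by `:=`, body verbatim), `anisotropicPlaneCentreTypeVanishes : AnisotropicPlaneCentreTypeVanishes`
(Z, B-p04 (g45)), `coinvDisjoint₁_of_kudlaLinesDisjoint : KudlaLinesDisjoint → CoinvDisjoint₁` (π2-J, A-p19 (g31)).

THE CHAIN (LD2-plan (g2) ROAD LEDGER 08:46:22Z; B-p04 (g44) memo v4 «(P) ⟺ DISJOINT»; RULING (β) 09:35Z; verbatim from the junction skeleton):
* (Z) `AnisotropicPlaneCentreTypeVanishes` — «at a place `v` of `L⁺` inert∕ramified in `L`, for an ANISOTROPIC hermitian plane `T₁ ⊕ αT₁`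
  (`(−α⁻¹, δ²)_v = −1`) and a splitting Hecke character `χ`, the centre character `e′ = ∏_w χ_w ∘ det` (the letter's `μ_v|_{E_v¹}`) does NOT occur in
  Kudla's CM Weil representation `ω_T ∘ s_T` of `U(T)(L⁺_v)`: `Coinv_{e′}(ω_T ∘ s_T ∘ (z ↦ z·1)) = 0`» — the target of the SOFT ROAD (π3): a vector of
  centre type `e′` doubles (Kronecker `ι : U(W ⊕ −W) → U(V ⊕ −V)`, ★ `LocalDoubledKroneckerEmbedding`; twisted section (TW); diagonal pairing) to a
  `ι(inl U(W))`-fixed vector `Φ` with `λ′(Φ) > 0` (★ `apply_zero_toRep_mul_localSplitting_eq_mul` eigen-law, ★ `modularCharacter_siegelDelta_eq_unitModulusChar`),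
  whence a NON-ZERO `U(W ⊕ −W)`-invariant functional (density glue (O2) over ★ `existsUnique_isSiegelDelta_mul_inlLoc_inv_of_rank_one` + ★
  `exists_rightInvariant_functional_of_isSiegelDelta_cm`), contradicting ★ `functional_eq_zero_of_forall_unipOpPi_eq_of_fourierOpPi` (S1+S2: a functional
  invariant under the anisotropic characters `ψ(b·q)` and Fourier-eigen is zero) through (J1a)(J1b).
* (E) `CentreDetCharExists` — the character `e′` exists with open kernel (★ `HeckeCharacter.isOpen_ker_localComponent`); support-size; PAID ★ p850926
  `Theorems/F0LD2CentreDetCharExists.lean` (head `centreDetCharExists`, body verbatim).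
* (D) `KudlaLinesDisjoint` — «the rank-one CM packages of the lines `−T₁` (through `toNegForm`) and `T₂ = αT₁` have DISJOINT type sets on open-kernel
  characters of the centre line `U(J′)`»; proved in the junction from (E)+(Z) by ★ E3 `nontrivial_theta_localSplittingCMWith_lines_iff_exists_type_neg_of_eq`.
* (C) `CoinvDisjoint₁` — VERBATIM the hypothesis `h` of ★ π1 `F0LD2LineComplementaryOfDisjoint.lineThetaTypesComplementary₁_of_coinv_disjoint` (the two
  same-`λ` transported δ-model line carriers of the letter have no common open-kernel coinvariant type at a guarded non-split place); ★ π1 gives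
  `CoinvDisjoint₁ → LineThetaTypesComplementary₁`.
* (π2-J) `KudlaLinesDisjoint → CoinvDisjoint₁` — the TRANSPORT: instantiate (D) at `T₁ := −a′·D`, `T₂ := a·D` (`D = realDiagonal L dV₁`, so
  `−T₁ = a′D`, `α = −a∕a′`, `(−α⁻¹, δ²)_v = (a′a⁻¹, δ²)_v = −1` from the guard by ★ `not_isNorm_of_eps_guard` + ★ `hilbertSymbol_eq_neg_one_of_not_isNorm`),
  `χ := toHeckeCharacter L λ`, `J′ := diag dV₁`, and identify the carriers `ω_D ∘ lineTransportSection(a) (𝓢_{λ,a})` with `ω_{aD} ∘ localSplittingCMWith(aD) ∘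
  (z ↦ z)` on types (★ `congrW_undoubledSplittings_cmFinLocalFamily_s`, ★ `LocalSplittingCMBlockRestriction*`, ★ `exists_linearEquiv_weightSpace_coinv`);
  the constant in front of `a`, `a′` (mod norms) is THE content of that stub and is deliberately NOT fixed by (D).

Print locators for the four statements (NOT cited facts — these are in-house organ bricks; the references below are where the reader finds the
surrounding mathematics): (E) Liu2021 App. D Lemma D.1 (1); GelbartRogawski1991 §3.2 p. 457.  (Z) GelbartRogawski1991 §3.2 (3.2.2)–(3.2.3) p. 457,
Remarks (2)–(3) p. 458; HarrisKudlaSweet1996 §6 Thm. 6.1; MoeglinVignerasWaldspurger1987 Chap. 3 §IV.4.  (D) HarrisKudlaSweet1996 §6 Thm. 6.1;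
MoeglinVignerasWaldspurger1987 Chap. 3 §IV.4; Kudla1994 §3 Thm. 3.1.  (C) MoeglinVignerasWaldspurger1987 Chap. 3 §IV.4 Théorème principal;
HarrisKudlaSweet1996 Cor. 4.4 p. 962; Liu2021 App. D Lemma D.1 (4) (p. 126).

HONEST LABEL.  Nothing of print is asserted and no organ is paid here: the file is a statement-only defs leaf.  HC_CM is proved only modulo the 7 printed
citations (2 remaining: hLiu418 = stmt-HodgeConjecture-24832, h413 = stmt-HodgeConjecture-24833) until rung 0 closes; count-neutral.

## References
* [GelbartRogawski1991] S. Gelbart, J. Rogawski, Invent. Math. 105 (1991), §3.1 Prop. 3.1.1, §3.2 (3.2.2)–(3.2.3) p. 457, Remarks (2)–(3) p. 458.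
* [HarrisKudlaSweet1996] M. Harris, S. Kudla, W. J. Sweet, J. AMS 9 (1996), §1 (1.15)–(1.16), §6 Thm. 6.1 (n = 1); Cor. 4.4 p. 962.
* [MoeglinVignerasWaldspurger1987] C. Mœglin, M.-F. Vignéras, J.-L. Waldspurger, LNM 1291 (1987), Chap. 2 II.1; Chap. 3 §IV.4–IV.5.
* [Kudla1994] S. Kudla, Israel J. Math. 87 (1994), §3 Thm. 3.1.
* [Liu2021] Y. Liu, Camb. J. Math. 9 (2021) = arXiv:2102.11518, App. D Lemma D.1 (1), (4); Prop. D.5.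
-/

set_option autoImplicit false
set_option linter.dupNamespace false

noncomputable section

open scoped Matrix Kronecker
open NumberField IsDedekindDomain MeasureTheory
open Literature.NumberTheory Literature.NumberTheory.Automorphic Literature.NumberTheory.Automorphic.UnitaryGroup
open Literature.RepresentationTheory Literature.RepresentationTheory.HeisenbergGroup Literature.RepresentationTheory.TwistedCoinv
open Literature.NumberTheory.GelbartRogawski1991 Literature.NumberTheory.GelbartRogawski1991.UnitaryDualPair
open Literature.NumberTheory.GelbartRogawski1991.UnitaryDualPair.WeilCoinv
open Literature.NumberTheory.GelbartRogawski1991.UnitaryDualPair.LocalSplitting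
open Literature.NumberTheory.GelbartRogawski1991.GRConstruction
open Literature.NumberTheory.Weil1964
open Literature.NumberTheory.GaloisRepresentations Literature.RepresentationTheory.HarrisKudlaSweet1996
open Literature.NumberTheory.Automorphic.IdeleClassGroup Literature.RepresentationTheory.Liu2021
open Literature.NumberTheory.Automorphic.Liu2021 Literature.NumberTheory.Automorphic.Liu2021.Def411WeilCarriers
open Literature.NumberTheory.Automorphic.Liu2021.Def411WeilCarriersDoubling
open Literature.NumberTheory.Automorphic.Liu2021.LemD1RankTwoCMLetters
open Literature.RepresentationTheory.MoeglinVignerasWaldspurger1987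
open Literature.NumberTheory.QuadraticForms
open Summit.HodgeConjecture.HodgeConjecture.Cruxes.HLiu418.F0LD2LineThetaTypesComplementaryDefs
open Summit.HodgeConjecture.HodgeConjecture.Cruxes.HLiu418.F0LD2LineComplementaryOfDisjoint

namespace Summit.HodgeConjecture.HodgeConjecture.Cruxes.HLiu418.F0LD2SoftRoadJunction

/-! ## §1 The four bricks (bodies byte-identical to the junction skeleton v2 :78–:166) -/

/-- (E) support: **the centre character `e′ = ∏_{w ∣ v} χ_w ∘ det` of the hermitian line `U(J′)(L⁺_v)` (read through `z ↦ z` into `U(J₁)`) exists as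
a character with OPEN kernel.** (locator, not a cited fact: Liu2021, App. D Lemma D.1 (1)) (locator, not a cited fact: GelbartRogawski1991, §3.2 p. 457) -/
def CentreDetCharExists : Prop :=
    ∀ (L : Type) [Field L] [NumberField L] [IsCMField L] (v : HeightOneSpectrum (𝓞 (maximalRealSubfield L)))
    {J₁ J' : Matrix (Fin 1) (Fin 1) L} (hJ'0 : J' 0 0 ≠ 0) (χ : HeckeCharacter L),
    ∃ e' : localPi L (IsCMField.complexConj L) 1 J' v →* ℂˣ,
      IsOpen (e'.ker : Set (localPi L (IsCMField.complexConj L) 1 J' v)) ∧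
      ∀ z, e' z = ∏ w' : PlacesOver L v, χ.localComponent w'.1 (Matrix.GeneralLinearGroup.det
        (((UnitaryGroup.localCenter L (IsCMField.complexConj L) 1 J₁ J' hJ'0 v z : localPi L (IsCMField.complexConj L) 1 J₁ v) :
          LocalGLPi L 1 v) w'))

set_option synthInstance.maxHeartbeats 400000 in
set_option maxHeartbeats 4000000 in -- block-currency terms (as ★ `LocalSplittingCMThetaCentreDoublingLines`)
/-- (Z) crux-interior, THE SOFT-ROAD TARGET (π3): **for an anisotropic hermitian plane `T = T₁ ⊕ αT₁` over a place `v` of `L⁺` that does not split in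
`L` (`(−α⁻¹, δ²)_v = −1`) and a splitting Hecke character `χ`, the centre character `e′ = ∏_w χ_w ∘ det` does NOT occur in Kudla's CM Weil
representation `ω_T ∘ s_T` of `U(T)(L⁺_v)` restricted to the centre `z ↦ z·1`.**  Why it might fail: only through a normalisation slip (the twist
`(χ_v∘det)⁻¹` of the doubled section against `e′` must cancel on `ι(inl U(W))`; an isotropic plane DOES carry the type). (locator, not a cited fact: GelbartRogawski1991, §3.2 (3.2.2)–(3.2.3) p. 457, Remarks (2)–(3) p. 458)
(locator, not a cited fact: HarrisKudlaSweet1996, §6 Thm. 6.1) (locator, not a cited fact: MoeglinVignerasWaldspurger1987, Chap. 3 §IV.4) -/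
def AnisotropicPlaneCentreTypeVanishes : Prop :=
    ∀ (L : Type) [Field L] [NumberField L] [IsCMField L] (v : HeightOneSpectrum (𝓞 (maximalRealSubfield L)))
    [MeasurableSpace (v.adicCompletion (maximalRealSubfield L))] [BorelSpace (v.adicCompletion (maximalRealSubfield L))]
    (μ : Measure (v.adicCompletion (maximalRealSubfield L))) [μ.IsAddHaarMeasure]
    (hE : IsField (UnitaryGroup.LocalRing L v))
    {T₁ T₂ : Matrix (Fin 1) (Fin 1) (maximalRealSubfield L)} (hT₁ : T₁.IsSymm) (hT₂ : T₂.IsSymm) (hT₁d : IsUnit T₁.det) (hT₂d : IsUnit T₂.det)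
    (α : (maximalRealSubfield L)ˣ) (hTT' : T₂ = (α : maximalRealSubfield L) • T₁)
    (hclass : hilbertSymbol (v.adicCompletion (maximalRealSubfield L))
      ((-(α : maximalRealSubfield L)⁻¹ : maximalRealSubfield L) : v.adicCompletion (maximalRealSubfield L))
      ((imagUnitSq L : maximalRealSubfield L) : v.adicCompletion (maximalRealSubfield L)) = -1)
    {T : Matrix (Fin (1 + 1)) (Fin (1 + 1)) (maximalRealSubfield L)} (hT : T = UnitaryGroup.finSum 1 1 T₁ T₂) (hTs : T.IsSymm) (hTd : IsUnit T.det)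
    {J₁ : Matrix (Fin 1) (Fin 1) L} (hJ₁ : J₁ = T₁.map (algebraMap (maximalRealSubfield L) L))
    {J : Matrix (Fin (1 + 1)) (Fin (1 + 1)) L} (hJ : J = T.map (algebraMap (maximalRealSubfield L) L))
    (χ : HeckeCharacter L) (hχ : IsSplittingChar L 1 χ) {J' : Matrix (Fin 1) (Fin 1) L} (hJ'0 : J' 0 0 ≠ 0)
    (e' : localPi L (IsCMField.complexConj L) 1 J' v →* ℂˣ) (he'o : IsOpen (e'.ker : Set (localPi L (IsCMField.complexConj L) 1 J' v)))
    (he' : ∀ z, e' z = ∏ w' : PlacesOver L v, χ.localComponent w'.1 (Matrix.GeneralLinearGroup.det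
      (((UnitaryGroup.localCenter L (IsCMField.complexConj L) 1 J₁ J' hJ'0 v z : localPi L (IsCMField.complexConj L) 1 J₁ v) :
        LocalGLPi L 1 v) w'))),
    ¬ Nontrivial (Coinv ((((MpPsi.toRep (localSchrodinger (maximalRealSubfield L) (1 + 1) T v)).comp
        (localSplittingCMWith L (1 + 1) hTs hTd hJ χ hχ v μ))).comp
        (UnitaryGroup.localCenter L (IsCMField.complexConj L) (1 + 1) J J' hJ'0 v)) e')

set_option synthInstance.maxHeartbeats 400000 in
set_option maxHeartbeats 4000000 in -- block-currency terms
/-- (D) **DISJOINTNESS of the rank-one CM line packages of `−T₁` (through `toNegForm`) and `T₂ = αT₁` for an anisotropic plane** — the right-hand side of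
★ `vanishingCentre_lines_eq_iff_forall_not_type_neg_of_eq`, quantified like (Z); proved below from (E)+(Z).
(locator, not a cited fact: HarrisKudlaSweet1996, §6 Thm. 6.1) (locator, not a cited fact: MoeglinVignerasWaldspurger1987, Chap. 3 §IV.4) (locator, not a cited fact: Kudla1994, §3 Thm. 3.1) -/
def KudlaLinesDisjoint : Prop :=
    ∀ (L : Type) [Field L] [NumberField L] [IsCMField L] (v : HeightOneSpectrum (𝓞 (maximalRealSubfield L)))
    [MeasurableSpace (v.adicCompletion (maximalRealSubfield L))] [BorelSpace (v.adicCompletion (maximalRealSubfield L))]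
    (μ : Measure (v.adicCompletion (maximalRealSubfield L))) [μ.IsAddHaarMeasure]
    (hE : IsField (UnitaryGroup.LocalRing L v))
    {T₁ T₂ : Matrix (Fin 1) (Fin 1) (maximalRealSubfield L)} (hT₁ : T₁.IsSymm) (hT₂ : T₂.IsSymm) (hT₁d : IsUnit T₁.det) (hT₂d : IsUnit T₂.det)
    (α : (maximalRealSubfield L)ˣ) (hTT' : T₂ = (α : maximalRealSubfield L) • T₁)
    (hclass : hilbertSymbol (v.adicCompletion (maximalRealSubfield L))
      ((-(α : maximalRealSubfield L)⁻¹ : maximalRealSubfield L) : v.adicCompletion (maximalRealSubfield L))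
      ((imagUnitSq L : maximalRealSubfield L) : v.adicCompletion (maximalRealSubfield L)) = -1)
    {T : Matrix (Fin (1 + 1)) (Fin (1 + 1)) (maximalRealSubfield L)} (hT : T = UnitaryGroup.finSum 1 1 T₁ T₂) (hTs : T.IsSymm) (hTd : IsUnit T.det)
    {J₁ : Matrix (Fin 1) (Fin 1) L} (hJ₁ : J₁ = T₁.map (algebraMap (maximalRealSubfield L) L))
    {J₁' : Matrix (Fin 1) (Fin 1) L} (hJ₁' : J₁' = (-T₁).map (algebraMap (maximalRealSubfield L) L))
    {J₂ : Matrix (Fin 1) (Fin 1) L} (hJ₂ : J₂ = T₂.map (algebraMap (maximalRealSubfield L) L))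
    {J : Matrix (Fin (1 + 1)) (Fin (1 + 1)) L} (hJ : J = T.map (algebraMap (maximalRealSubfield L) L))
    (χ : HeckeCharacter L) (hχ : IsSplittingChar L 1 χ) {J' : Matrix (Fin 1) (Fin 1) L} (hJ'0 : J' 0 0 ≠ 0),
    ∀ ζ : localPi L (IsCMField.complexConj L) 1 J' v →* ℂˣ, IsOpen (ζ.ker : Set (localPi L (IsCMField.complexConj L) 1 J' v)) →
      Nontrivial (Coinv ((((MpPsi.toRep (localSchrodinger (maximalRealSubfield L) 1 (-T₁) v)).comp
        (localSplittingCMWith L 1 hT₁.neg (isUnit_det_neg_of_isUnit (maximalRealSubfield L) 1 hT₁d) hJ₁' χ hχ v μ))).comp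
        ((toNegForm (maximalRealSubfield L) L (IsCMField.complexConj L) v 1 hJ₁ hJ₁').toMonoidHom.comp
          (UnitaryGroup.localCenter L (IsCMField.complexConj L) 1 J₁ J' hJ'0 v))) ζ) →
      ¬ Nontrivial (Coinv ((((MpPsi.toRep (localSchrodinger (maximalRealSubfield L) 1 T₂ v)).comp
        (localSplittingCMWith L 1 hT₂ hT₂d hJ₂ χ hχ v μ))).comp
        (UnitaryGroup.localCenter L (IsCMField.complexConj L) 1 J₂ J' hJ'0 v)) ζ)

set_option synthInstance.maxHeartbeats 400000 in
set_option maxHeartbeats 4000000 in -- the CM θ-package section terms (as ★ `F0LD2LineThetaTypesComplementaryDefs`, 4 M)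
/-- (C) **COINVARIANT DISJOINTNESS of the letter's two same-`λ` transported line carriers at every guarded non-split place** — VERBATIM the hypothesis
`h` of ★ `F0LD2LineComplementaryOfDisjoint.lineThetaTypesComplementary₁_of_coinv_disjoint`. (locator, not a cited fact: MoeglinVignerasWaldspurger1987, Chap. 3 §IV.4 Théorème principal)
(locator, not a cited fact: HarrisKudlaSweet1996, Cor. 4.4 p. 962) (locator, not a cited fact: Liu2021, App. D Lemma D.1 (4) (p. 126)) -/
def CoinvDisjoint₁ : Prop :=
    ∀ (L : Type) [Field L] [NumberField L] [IsCMField L]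
    (dV₁ : Fin 1 → L) (hdV₁ : ∀ i, IsCMField.complexConj L (dV₁ i) = dV₁ i) (hdV0₁ : ∀ i, dV₁ i ≠ 0)
    (lam : Literature.NumberTheory.Automorphic.IdeleClassGroup L →ₜ* Circle) (hlam : IsConjugateSymplectic L lam)
    (a a' : (↥(maximalRealSubfield L))ˣ) (v : HeightOneSpectrum (𝓞 ↥(maximalRealSubfield L))),
    (∀ w : UnitaryGroup.PlacesOver L v, IsCMField.complexConj L • (w : HeightOneSpectrum (𝓞 L)) = w) →
    (¬ ∃ x : (LocalRing L v)ˣ, LemD1OfPlace.eps L v (lineDelta_ne_zero (imagUnit_ne_zero L) a) =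
        x * Units.map (conjLocal L (IsCMField.complexConj L) v : LocalRing L v →* LocalRing L v) x *
          LemD1OfPlace.eps L v (lineDelta_ne_zero (imagUnit_ne_zero L) a')) →
    ∀ ξ : (localPi L (IsCMField.complexConj L) 1 (Matrix.diagonal dV₁) v) →* ℂˣ,
      IsOpen (ξ.ker : Set (localPi L (IsCMField.complexConj L) 1 (Matrix.diagonal dV₁) v)) →
      Nontrivial (TwistedCoinv.Coinv ((MpPsi.toRep (localSchrodinger (Fp L) 1 (realDiagonal L dV₁ hdV₁) v)).comp
          (lineTransportSection (Fp L) L (IsCMField.complexConj L) 1 (complexConj_imagUnit L) (imagUnit_ne_zero L) (imagUnit_mul_self L) (realDiagonal L dV₁ hdV₁) (realDiagonal_isSymm L dV₁ hdV₁) (Matrix.diagonal dV₁) (realDiagonal_map L dV₁ hdV₁).symm a' v ((congrW L (Equiv.prodUnique (Fin 1) (Fin 1)) dV₁ hdV₁ (lineW L (TW (Fp L) a')) (complexConj_lineW L (TW (Fp L) a')) (realDiagonal_lineW L (TW (Fp L) a')) (diagonal_lineW L (TW (Fp L) a') (JW_eq (Fp L) L a')) (undoubledSplittings L (Equiv.prodUnique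 (Fin 1) (Fin 1)) dV₁ hdV₁ hdV0₁ (lineW L (TW (Fp L) a')) (complexConj_lineW L (TW (Fp L) a')) (lineW_ne_zero L (TW (Fp L) a') (isUnit_det_TW (Fp L) a')) (toHeckeCharacter L lam) (borelPlaceMeasure L) (cmFinLocalFamily L (Equiv.prodUnique (Fin 1) (Fin 1)) dV₁ hdV₁ hdV0₁ (lineW L (TW (Fp L) a')) (complexConj_lineW L (TW (Fp L) a')) (lineW_ne_zero L (TW (Fp L) a') (isUnit_det_TW (Fp L) a')) (toHeckeCharacter L lam) ((isOscillatorChar_toHeckeCharacter_iff lam).mpr hlam) (borelPlaceMeasure L))) (isSymm_TW (Fp L) a') (JW_eq (Fp L) L a')).s v) ((congrW L (Equiv.prodUnique (Fin 1) (Fin 1)) dV₁ hdV₁ (lineW L (TW (Fp L) a')) (complexConj_lineW L (TW (Fp L) a')) (realDiagonal_lineW L (TW (Fp L) a')) (diagonal_lineW L (TW (Fp L) a') (JW_eq (Fp L) L a')) (undoubledSplittings L (Equiv.prodUnique (Fin 1) (Fin 1)) dV₁ hdV₁ hdV0₁ (lineW L (TW (Fp L) a')) (complexConj_lineW L (TW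 (Fp L) a')) (lineW_ne_zero L (TW (Fp L) a') (isUnit_det_TW (Fp L) a')) (toHeckeCharacter L lam) (borelPlaceMeasure L) (cmFinLocalFamily L (Equiv.prodUnique (Fin 1) (Fin 1)) dV₁ hdV₁ hdV0₁ (lineW L (TW (Fp L) a')) (complexConj_lineW L (TW (Fp L) a')) (lineW_ne_zero L (TW (Fp L) a') (isUnit_det_TW (Fp L) a')) (toHeckeCharacter L lam) ((isOscillatorChar_toHeckeCharacter_iff lam).mpr hlam) (borelPlaceMeasure L))) (isSymm_TW (Fp L) a') (JW_eq (Fp L) L a')).proj_s v))) ξ) →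
        Nontrivial (TwistedCoinv.Coinv ((MpPsi.toRep (localSchrodinger (Fp L) 1 (realDiagonal L dV₁ hdV₁) v)).comp
          (lineTransportSection (Fp L) L (IsCMField.complexConj L) 1 (complexConj_imagUnit L) (imagUnit_ne_zero L) (imagUnit_mul_self L) (realDiagonal L dV₁ hdV₁) (realDiagonal_isSymm L dV₁ hdV₁) (Matrix.diagonal dV₁) (realDiagonal_map L dV₁ hdV₁).symm a v ((congrW L (Equiv.prodUnique (Fin 1) (Fin 1)) dV₁ hdV₁ (lineW L (TW (Fp L) a)) (complexConj_lineW L (TW (Fp L) a)) (realDiagonal_lineW L (TW (Fp L) a)) (diagonal_lineW L (TW (Fp L) a) (JW_eq (Fp L) L a)) (undoubledSplittings L (Equiv.prodUnique (Fin 1) (Fin 1)) dV₁ hdV₁ hdV0₁ (lineW L (TW (Fp L) a)) (complexConj_lineW L (TW (Fp L) a)) (lineW_ne_zero L (TW (Fp L) a) (isUnit_det_TW (Fp L) a)) (toHeckeCharacter L lam) (borelPlaceMeasure L) (cmFinLocalFamily L (Equiv.prodUnique (Fin 1) (Fin 1)) dV₁ hdV₁ hdV0₁ (lineW L (TW (Fp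 L) a)) (complexConj_lineW L (TW (Fp L) a)) (lineW_ne_zero L (TW (Fp L) a) (isUnit_det_TW (Fp L) a)) (toHeckeCharacter L lam) ((isOscillatorChar_toHeckeCharacter_iff lam).mpr hlam) (borelPlaceMeasure L))) (isSymm_TW (Fp L) a) (JW_eq (Fp L) L a)).s v) ((congrW L (Equiv.prodUnique (Fin 1) (Fin 1)) dV₁ hdV₁ (lineW L (TW (Fp L) a)) (complexConj_lineW L (TW (Fp L) a)) (realDiagonal_lineW L (TW (Fp L) a)) (diagonal_lineW L (TW (Fp L) a) (JW_eq (Fp L) L a)) (undoubledSplittings L (Equiv.prodUnique (Fin 1) (Fin 1)) dV₁ hdV₁ hdV0₁ (lineW L (TW (Fp L) a)) (complexConj_lineW L (TW (Fp L) a)) (lineW_ne_zero L (TW (Fp L) a) (isUnit_det_TW (Fp L) a)) (toHeckeCharacter L lam) (borelPlaceMeasure L) (cmFinLocalFamily L (Equiv.prodUnique (Fin 1) (Fin 1)) dV₁ hdV₁ hdV0₁ (lineW L (TW (Fp L) a)) (complexConj_lineW L (TW (Fp L) a)) (lineW_ne_zero L (TW (Fp L) a) (isUnit_det_TW (Fp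 L) a)) (toHeckeCharacter L lam) ((isOscillatorChar_toHeckeCharacter_iff lam).mpr hlam) (borelPlaceMeasure L))) (isSymm_TW (Fp L) a) (JW_eq (Fp L) L a)).proj_s v))) ξ) → False


end Summit.HodgeConjecture.HodgeConjecture.Cruxes.HLiu418.F0LD2SoftRoadJunction

end
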